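import Summits.BirchSwinnertonDyer.BirchSwinnertonDyer.Theses.SignedLowerHalves
import Summits.BirchSwinnertonDyer.BirchSwinnertonDyer.Theorems.SprungSharpFlatMainConjectureEdges
import Summits.BirchSwinnertonDyer.BirchSwinnertonDyer.Theorems.SignedLowerHalvesSprungLowerHalfAtThreeChromaticReduction
import Literature.NumberTheory.EllipticCurves.Sprung2017.SharpFlatPAdicLFunctionProofs
import Summits.BirchSwinnertonDyer.BirchSwinnertonDyer.Theorems.SignedLowerHalvesSprungLowerHalfAtThreeTamagawaZone
import Summits.BirchSwinnertonDyer.Rank1Residual.Supersingular.SharpFlatConverseReal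
import Literature.NumberTheory.EllipticCurves.Sprung2012.SharpFlatSelmerDualExistsProofs
import Literature.NumberTheory.EllipticCurves.Sprung2012.SharpFlatKatoDivisibility
import Literature.NumberTheory.EllipticCurves.Sprung2012.ColemanMapTheorems
import Literature.NumberTheory.EllipticCurves.Sprung2017.SharpFlatNonvanishingProofs
import Literature.NumberTheory.EllipticCurves.Sprung2024.ChromaticCharValueRankZeroAllN
import Literature.NumberTheory.EllipticCurves.CyclotomicZpExtensionLocalGeneratorProofs
import HarnessLib

/-!
# Route `SignedLowerHalves`, crux 5 — the split's open child K1 `SprungLowerDivisibilityAtThree`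
# (item stmt-BirchSwinnertonDyer-19875) ON THE ASSEMBLY'S BRANCH X8 ∧ Surj(3) ∧ `r_an = 0`:
# per pair it FOLLOWS from `BSD(E,3)`, and on the branch it is EQUIVALENT to `BSD(E,3)`
# (cell `bsd-ssimc`, seat `bsd-ssimc-k3-c5` g9, object «K1-BRANCH»; `--supports … --as helper`)

PARTITION (cell bsd-ssimc): X8 (A8) ∩ {r_an = 0} ∩ Surj(3), `p = 3` (the branch on which the route's
assembly `SignedSupersingularInputs` consumes crux 5); types-the-object-of (the crux child K1 restricted
to that branch, in Sprung's REAL currency); closes NONE; 0 census moves; BSD is not proved by any of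
this.

## What this file proves

After the tenure planner's split of crux 5 (route rev 13/14) and the kernel reduction K2 ⟸ K1
(`…SplitConverse.lean`), the ONE open mathematical child of crux 5 is
K1 = `SprungLowerDivisibilityAtThree` = «for every X8 pair and every colour `•`,
`Theorems.SprungSharpFlatLowerDivisibility W 3 •`» — the Eisenstein half of Sprung 2012 Main Conj. 7.21
on Sprung's REAL `X^•(E/ℚ_∞)` (`Sprung2012.SharpFlatSelmerDualData`), OPEN IN PRINT at `(3, a_3 = ±3)`.
K1 quantifies over ALL X8 pairs (every analytic rank, every image); the assembly uses crux 5 only on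
X8 ∧ `r_an = 0` ∧ Surj(3). This file measures K1 against that branch, in the kernel:

* `sprungSharpFlatMainConjecture_of_bsdp` — **per pair, REAL currency, ⟸**: on X8 ∧ Surj(3) ∧
  `r_an = 0`, a settled `BSDp W 3` gives Sprung's FULL Main Conjecture 1.3 / 7.21
  `Theorems.SprungSharpFlatMainConjecture W 3 •` for BOTH colours (each guarded by `L^• ≠ 0`), hence
  K1's predicate `SprungSharpFlatLowerDivisibility W 3 •` at the pair
  (`sprungSharpFlatLowerDivisibility_of_bsdp`). Inputs BY NAME, all published: Sprung 2012 Thm. 7.14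
  (`thm714_…`: `X^•` finitely generated `Λ`-torsion), Thm. 7.16 (`thm716_…`: Kato's `gen ∣ L^•`,
  `n = 0` under `3`-adic surjectivity, which Wuthrich 2014 Lemma 20 `hL20` gives from Surj(3) at a good
  `3`), Sprung 2024 Lemmas 5.5–5.9 at all levels (`lem59AllN_…` = the split's child K3), the period
  unit at `3` (`realPeriodRat_eq_unit_mul_plusPeriod_three`, Mazur + Greenberg–Vatsal), GZK,
  modularity (`hasEntireLFunction_rat`). Proof: `char_Λ(X^•)` is principal (`Λ` a UFD,
  `charIdeal_isPrincipal_holds`), (K•) pins `ord₃ gen(0) = ord₃(#Ш · ∏c_ℓ)`, (P•) is the THEOREM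
  `constantCoeff_chromaticL_of_isSprungPair_of_isNewformOf`, `BSD(E,3)` equates the two constant-term
  valuations and Kato's divisibility becomes an equality of ideals by `Λ`-rigidity — b2b's
  `X8.span_eq_span_chromaticL_of_bsdp_of_analyticRank_eq_zero` (abstract datum), here re-targeted to
  the REAL `X^•` and to the leaf's `ϖ`-normalised conclusion (`ϖ` is a `3`-adic unit on X8,
  `X8_norm_periodRatio_eq_one`).
* `sprungLowerDivisibility_branch_iff_bsdp_branch` — **the branch equivalence (class statement)**:
  modulo the same named facts plus the split's held inputs S4 (`SharpFlatPublishedInputsAtThree`: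
  newform, Honda system, torsion — for the ⟹ direction's objects),
  `(∀ X8 ∧ Surj ∧ r0, ∀ •, SprungSharpFlatLowerDivisibility W 3 •) ↔ (∀ X8 ∧ Surj ∧ r0, BSDp W 3)`.
  ⟹: the Rohrlich colour, the real datum, K1's generator `gen` with `ι gen = ϖ·ι(L^•·h)` (so
  `L^• ∣ gen`), Kato's `gen ∣ L^•`, hence `(gen) = (L^•)`, hence `BSDp` by b2b's exact form
  `X8.bsdp_iff_span_eq_span_chromaticL_of_analyticRank_eq_zero`. ⟸: the first bullet.
* `sprungLowerDivisibilityAtThree_iff_bsdp_branch_and_offBranch` — **K1 BY NAME, decomposed**: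
  `SprungLowerDivisibilityAtThree ↔ (∀ X8 ∧ Surj ∧ r0, BSDp W 3) ∧ (K1 on the X8 pairs with ¬Surj(3)
  or r_an ≠ 0)`. READING: on the branch the route uses, the crux child K1 is EQUIVALENT to the rung's
  missing input there (its `Λ`-adic surplus over the parent is NIL on that branch); K1's genuinely open
  surplus is exactly its off-branch content (positive analytic rank, and the non-surjective rank-0
  pairs where Kato's exponent `n` may be positive).

HONEST STATUS: CONDITIONAL on the displayed named facts (all PUBLISHED; `lem59AllN` carries littype-11's
flag `Sprung24-§5.2-allN-via-RaySprung25`); per-pair theorems close nothing at class level; K1, K2 and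
crux 5 stay OPEN; 0 cells move (every `BSDp W 3` consumed is already a tree theorem or an input).
What this is NOT: not a proof of K1, not a new engine; BSD is not proved by any of this.

References: [Sprung2012] Thm. 1.2/7.14, Thm. 1.4/7.16, Prop. 6.14, Def. 7.11, Main Conj. 1.3/7.21
(pp. 1486, 1503–1505); [Sprung2024] §5.2 Lemmas 5.5–5.9 (pp. 40–41), Rem. 5.4; [RaySprung2025]
p. 2343; [Sprung2017] Thm. 1.12, Cor. 4.11; [Wuthrich2014] Lemma 20 (p. 399); [Mazur1978] Cor. 4.1;
[GreenbergVatsal2000] §3 Rem. 3.4; [Washington1997] §13.2; [Miller2011LMS] Def. 1.1.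
-/

set_option autoImplicit false
-- justification: the mandated namespace `Summit.BirchSwinnertonDyer.BirchSwinnertonDyer.Theorems`
-- (single-conjunct summit, Sub = Summit) repeats a segment by design (D-0017).
set_option linter.dupNamespace false

noncomputable section

namespace Summit.BirchSwinnertonDyer.BirchSwinnertonDyer.Theorems.K1Branch

open scoped Classical NumberField MatrixGroups ModularForm
open NumberField IsDedekindDomain WeierstrassCurve CongruenceSubgroup
  Literature.NumberTheory.EllipticCurves Literature.NumberTheory.EllipticCurves.ModularForms
  Literature.NumberTheory.EllipticCurves.Rank1Residual
  Literature.NumberTheory.EllipticCurves.Rank1Residual.Typed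
  Literature.NumberTheory.EllipticCurves.Sprung2017 Literature.NumberTheory.EllipticCurves.Sprung2012
  Literature.NumberTheory.EllipticCurves.Sprung2024
  Literature.NumberTheory.EllipticCurves.ZpExtension
  Summit.BirchSwinnertonDyer.Rank1Residual.Supersingular
  Summit.BirchSwinnertonDyer.BirchSwinnertonDyer.Theses.SignedLowerHalves

/-! ### §1. Per pair, real currency: `BSD(E,3)` ⇒ Sprung's Main Conjecture 7.21 at the pair -/

/-- **X8 ∧ Surj(3) ∧ `r_an = 0`: a settled `BSD(E,3)` gives Sprung's ♯/♭ Main Conjecture 1.3 / 7.21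
`Theorems.SprungSharpFlatMainConjecture W 3 •` on the REAL `X^•(E/ℚ_∞)`, for EITHER colour** (each
guarded by `L^• ≠ 0` inside the leaf). Named inputs (published): Sprung 2012 Thm. 7.14 (`h714`),
Thm. 7.16 (`h716`, Kato side; `n = 0` from `3`-adic surjectivity = Wuthrich 2014 Lemma 20 `hL20` +
Surj(3) at the good prime `3`), Sprung 2024 Lemmas 5.5–5.9 at all levels (`h59` = child K3), the period
unit at `3` (`h3`), GZK (`hGZK`), modularity (`hmod`). Per-pair data: `hX`, `hs`, `h0`, `hB`. Proof:
a generator `gen` of `char_Λ(X^•)` exists (`Λ` is a UFD); (K•) for `⟨gen, 0, 0⟩`; Kato `gen ∣ L^•`;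
b2b's squeeze `X8.span_eq_span_chromaticL_of_bsdp_of_analyticRank_eq_zero` gives `(gen) = (L^•)`;
`ϖ ∈ ℤ_3^×` (`X8_norm_periodRatio_eq_one`) so `ϖ·L^•` generates the same ideal. PER PAIR; closes
nothing at class level. [cite: Sprung2012, Thm. 7.14, Thm. 7.16 and Main Conj. 7.21 (pp. 1504–1505)]
[cite: Sprung2024, §5.2 Lemmas 5.5–5.9 (pp. 40–41)] [cite: Wuthrich2014, Lemma 20 (p. 399)]
[cite: Washington1997, §13.2] [cite: Miller2011LMS, Def. 1.1] -/
theorem sprungSharpFlatMainConjecture_of_bsdp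
    (h714 : thm714_sharpFlatSelmerDual_finite_torsion)
    (h716 : thm716_sharpFlatCharIdeal_divisibility)
    (h59 : lem59AllN_sharpFlatCharValue_rankZero)
    (h3 : realPeriodRat_eq_unit_mul_plusPeriod_three)
    (hL20 : Wuthrich2014.lemma20_surjective_threeAdic_of_semistable)
    (hGZK : rank_eq_analyticRank_of_analyticRank_le_one) (hmod : hasEntireLFunction_rat)
    (W : WeierstrassCurve ℚ) [W.IsElliptic] [W.IsGloballyMinimal] (p : ℕ) [Fact p.Prime]
    (hX : ClassX8 W p) (hs : Surj W p) (h0 : W.analyticRank = 0) (hB : BSDp W p) (col : Chroma) :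
    SprungSharpFlatMainConjecture W p col := by
  intro κ γ hκ hγ hγ' v hv g hg cneg c hc N hN f ϖ Lsharp Lflat hf hϖ hSP hcol D
  haveI := hN
  have hp3 : p = 3 := hX.1
  subst hp3
  have hp2 : (3 : ℕ) ≠ 2 := by decide
  have hgood : W.HasGoodReductionAtPrime 3 := hX.2.1.1
  have hdvd : ((3 : ℕ) : ℤ) ∣ W.frobeniusTrace 3 := hX.2.1.2
  have hL : W.entireLFunction 1 ≠ 0 := (W.analyticRank_eq_zero_iff_holds (hmod W)).1 h0
  -- Sprung 2012 Thm. 7.14: `X^•` finitely generated and `Λ`-torsion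
  obtain ⟨hfinD, htorD⟩ :=
    h714 W 3 hp2 hgood hdvd f hf κ γ hκ hγ hγ' v hv g hg cneg c hc col Lsharp Lflat hSP hcol D
  haveI := hfinD
  -- a generator of `char_Λ(X^•)` (`Λ` is a UFD)
  obtain ⟨gen, hgen⟩ := (charIdeal_isPrincipal_holds 3 D.X).principal
  have hchar : D.charIdeal = Ideal.span {gen} := hgen
  -- (K•) by name (Sprung 2024 Lemmas 5.5–5.9, all levels)
  have hK : (⟨gen, 0, 0⟩ : SignedDatum W 3).EulerCharacteristic := fun hfin =>
    h59 W 3 hp2 hgood hdvd hL κ γ hκ hγ hγ' v hv g hg cneg c hc col D htorD gen hchar hfin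
  -- (MC↑•) integral under `3`-adic surjectivity (Sprung 2012 Thm. 7.16, `n = 0`)
  have hKato : (∀ n : ℕ, W.HasSurjectiveModNGaloisRep (3 ^ n : ℕ)) →
      gen ∣ chromaticL col Lsharp Lflat := fun hsurj =>
    h716.dvd_of_charIdeal_eq_span hp2 hgood hdvd hf hκ hγ hγ' hv hg hc hSP hcol D htorD hsurj hchar
  -- the squeeze on the real `L^•`: `(gen) = (L^•)`
  have hspan : Ideal.span ({gen} : Set (IwasawaAlgebra 3)) =
      Ideal.span {chromaticL col Lsharp Lflat} :=
    X8.span_eq_span_chromaticL_of_bsdp_of_analyticRank_eq_zero W 3 h3 hL20 hGZK hmod hX hs h0 hB hf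
      hSP col gen hK hKato
  -- `ϖ` is a `3`-adic unit on X8
  have hϖ1 : ‖(ϖ : ℚ_[3])‖ = 1 := X8_norm_periodRatio_eq_one h3 W 3 hX hf hϖ
  obtain ⟨hspan', hι⟩ := span_C_units_mul_eq (PadicInt.mkUnits hϖ1) (chromaticL col Lsharp Lflat)
  refine ⟨htorD, PowerSeries.C ((PadicInt.mkUnits hϖ1 : ℤ_[3]ˣ) : ℤ_[3]) *
    chromaticL col Lsharp Lflat, ?_, ?_⟩
  · rw [hchar, hspan, hspan']
  · rw [hι, PadicInt.mkUnits_eq]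

/-- **K1's predicate at the pair**: on X8 ∧ Surj(3) ∧ `r_an = 0`, a settled `BSD(E,3)` gives
`Theorems.SprungSharpFlatLowerDivisibility W 3 •` for EITHER colour (the Eisenstein half, `h = 1`, of
the full Main Conjecture just proved at the pair; littype-11's edge
`sprungSharpFlatLowerDivisibility_of_mainConjecture`). PER PAIR; closes nothing at class level.
[cite: Sprung2012, Main Conj. 1.3 (p. 1486) and Main Conj. 7.21 (p. 1505)]
[cite: Sprung2024, §5.2 Lemmas 5.5–5.9 (pp. 40–41)] -/
theorem sprungSharpFlatLowerDivisibility_of_bsdp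
    (h714 : thm714_sharpFlatSelmerDual_finite_torsion)
    (h716 : thm716_sharpFlatCharIdeal_divisibility)
    (h59 : lem59AllN_sharpFlatCharValue_rankZero)
    (h3 : realPeriodRat_eq_unit_mul_plusPeriod_three)
    (hL20 : Wuthrich2014.lemma20_surjective_threeAdic_of_semistable)
    (hGZK : rank_eq_analyticRank_of_analyticRank_le_one) (hmod : hasEntireLFunction_rat)
    (W : WeierstrassCurve ℚ) [W.IsElliptic] [W.IsGloballyMinimal] (p : ℕ) [Fact p.Prime]
    (hX : ClassX8 W p) (hs : Surj W p) (h0 : W.analyticRank = 0) (hB : BSDp W p) (col : Chroma) :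
    SprungSharpFlatLowerDivisibility W p col :=
  sprungSharpFlatLowerDivisibility_of_mainConjecture
    (sprungSharpFlatMainConjecture_of_bsdp h714 h716 h59 h3 hL20 hGZK hmod W p hX hs h0 hB col)

/-! ### §2. The branch: K1's predicate ⟹ `BSD(E,3)` per pair, from the split's held inputs -/

/-- **X8 ∧ Surj(3) ∧ `r_an = 0`: K1's predicate for BOTH colours at the pair gives `BSD(E,3)`**,
granted the split's held published inputs S4 (`hS4`: a newform of `W`; in Sprung's cyclotomic setting a
Honda system, Thm. 2.2; `Λ`-torsion of `X^•` for `L^• ≠ 0`, Thm. 7.14), (K•) at all levels (`h59` =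
child K3), Kato's side (`h716` with `hL20`), the period unit (`h3`), GZK, modularity. Proof: real
objects `(f, ϖ, L♯, L♭)` (S4(M); `ϖ := u⁻¹` from `h3`; Sprung 2017 Thm. 1.12, PROVED); the cyclotomic `(κ, γ)`, the
place `v ∋ 3`, the PROVED local lift `g` (p473737); the Honda system from S4; the Rohrlich colour `•`
with `L^• ≠ 0` (Sprung 2012 Prop. 6.14, tree theorem); `D :=` the real `X^•` (p470048); K1's
predicate gives `char(D.X) = (gen)` with `ι gen = ϖ·ι(L^•·h)`, so `L^• ∣ gen` (`ϖ ∈ ℤ_3^×`); Kato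
gives `gen ∣ L^•`; so `(gen) = (L^•)` and b2b's exact form
`X8.bsdp_iff_span_eq_span_chromaticL_of_analyticRank_eq_zero` yields `BSDp W 3`. PER PAIR;
CONDITIONAL on the displayed hypotheses; closes nothing.
[cite: Sprung2012, Thm. 2.2, Prop. 6.14, Thm. 7.14, Thm. 7.16 and Main Conj. 7.21]
[cite: Sprung2024, §5.2 Lemmas 5.5–5.9 (pp. 40–41)] [cite: Wuthrich2014, Lemma 20 (p. 399)]
[cite: Miller2011LMS, Def. 1.1] -/
theorem bsdp_of_sprungSharpFlatLowerDivisibility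
    (hS4 : SharpFlatPublishedInputsAtThree)
    (h716 : thm716_sharpFlatCharIdeal_divisibility)
    (h59 : lem59AllN_sharpFlatCharValue_rankZero)
    (h3 : realPeriodRat_eq_unit_mul_plusPeriod_three)
    (hL20 : Wuthrich2014.lemma20_surjective_threeAdic_of_semistable)
    (hGZK : rank_eq_analyticRank_of_analyticRank_le_one) (hmod : hasEntireLFunction_rat)
    (W : WeierstrassCurve ℚ) [W.IsElliptic] [W.IsGloballyMinimal] (p : ℕ) [Fact p.Prime]
    (hX : ClassX8 W p) (hs : Surj W p) (h0 : W.analyticRank = 0)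
    (hK1 : ∀ col : Chroma, SprungSharpFlatLowerDivisibility W p col) : BSDp W p := by
  -- S4(M): a newform `f` of `W`
  obtain ⟨⟨N, hN, f, hf⟩, hS4'⟩ := hS4 W p hX
  haveI := hN
  have hp3 : p = 3 := hX.1
  subst hp3
  have hp2 : (3 : ℕ) ≠ 2 := by decide
  have hgood : W.HasGoodReductionAtPrime 3 := hX.2.1.1
  have hdvd : ((3 : ℕ) : ℤ) ∣ W.frobeniusTrace 3 := hX.2.1.2
  have hL : W.entireLFunction 1 ≠ 0 := (W.analyticRank_eq_zero_iff_holds (hmod W)).1 h0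
  -- the real objects `(ϖ, L♯, L♭)`: `ϖ := u⁻¹` from the period fact at `3` (`Ω_W = u · Ω⁺_f`,
  -- `|u|₃ = 1`), and a Sprung pair for `f` (Sprung 2017 Thm. 1.12, PROVED in the tree)
  obtain ⟨u, hu1, hΩu⟩ := h3 W hgood (ClassX8.irr W 3 hX) f hf
  have hu0 : u ≠ 0 := by
    rintro rfl
    rw [Rat.cast_zero, norm_zero] at hu1
    exact zero_ne_one hu1
  set ϖ : ℚ := u⁻¹ with hϖ_def
  have hϖ : (ϖ : ℝ) * W.realPeriodRat = plusPeriod f := by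
    rw [hΩu, hϖ_def, Rat.cast_inv, ← mul_assoc, inv_mul_cancel₀ (Rat.cast_ne_zero.mpr hu0), one_mul]
  obtain ⟨Lsharp, Lflat, hSP⟩ :=
    thm112_exists_isSprungPair_holds (W := W) (f := f) (p := 3) hp2 hf hgood hdvd
  -- the cyclotomic setting, the place above `3`, the local lift (PROVED, p473737), a Honda system
  obtain ⟨κ, hκ, γ, hγ, hγ'⟩ := exists_isCyclotomic_isTopGenerator_isCyclotomicVariable_holds 3
  obtain ⟨v, hv⟩ :=
    Literature.NumberTheory.NumberFields.RingOfIntegers.exists_heightOneSpectrum_natCast_mem ℚ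
      (p := 3) (by norm_num)
  obtain ⟨g, hg⟩ := hκ.exists_isTopGenerator_resGalOfEmb_adicCompletion v hv
  obtain ⟨⟨cneg, c, hc⟩, h714⟩ := hS4' κ γ hκ hγ hγ' v hv g hg
  -- the Rohrlich colour (Sprung 2012 Prop. 6.14, tree theorem) and the real `X^•` (p470048)
  obtain ⟨col, hcol⟩ := hSP.exists_chromaticL_ne_zero hf hgood
  let D := sharpFlatSelmerDualData W κ (closureEmb (K := ℚ) (v.adicCompletion ℚ))
    (W.frobeniusTrace 3) g c col hγ
  -- K1's predicate at the pair: a generator divisible by `ϖ · L^•`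
  obtain ⟨gen, h, hchar, hι⟩ :=
    hK1 col κ γ hκ hγ hγ' v hv g hg cneg c hc N hN f ϖ Lsharp Lflat hf hϖ hSP hcol D
  -- torsion (S4(T)), (K•), Kato
  obtain ⟨hfinD, htorD⟩ := h714 cneg c hc N hN f hf col Lsharp Lflat hSP hcol D
  haveI := hfinD
  have hK : (⟨gen, 0, 0⟩ : SignedDatum W 3).EulerCharacteristic := fun hfin =>
    h59 W 3 hp2 hgood hdvd hL κ γ hκ hγ hγ' v hv g hg cneg c hc col D htorD gen hchar hfin
  have hsurj : ∀ n : ℕ, W.HasSurjectiveModNGaloisRep (3 ^ n : ℕ) :=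
    surjective_pow_of_surj_of_good W 3 hL20 hp2 hgood hs
  have hKato : gen ∣ chromaticL col Lsharp Lflat :=
    h716.dvd_of_charIdeal_eq_span hp2 hgood hdvd hf hκ hγ hγ' hv hg hc hSP hcol D htorD hsurj hchar
  -- `L^• ∣ gen`: `ι gen = ϖ · ι(L^• · h)` with `ϖ ∈ ℤ_3^×`
  have hϖ1 : ‖(ϖ : ℚ_[3])‖ = 1 := X8_norm_periodRatio_eq_one h3 W 3 hX hf hϖ
  have hgen_eq : gen = PowerSeries.C ((PadicInt.mkUnits hϖ1 : ℤ_[3]ˣ) : ℤ_[3]) *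
      (chromaticL col Lsharp Lflat * h) := by
    apply iwasawaToPowerSeries_injective 3
    obtain ⟨-, hι'⟩ := span_C_units_mul_eq (PadicInt.mkUnits hϖ1) (chromaticL col Lsharp Lflat * h)
    rw [hι, hι', PadicInt.mkUnits_eq]
  have hLgen : chromaticL col Lsharp Lflat ∣ gen :=
    ⟨PowerSeries.C ((PadicInt.mkUnits hϖ1 : ℤ_[3]ˣ) : ℤ_[3]) * h, by rw [hgen_eq]; ring⟩
  have hspan : Ideal.span ({gen} : Set (IwasawaAlgebra 3)) =
      Ideal.span {chromaticL col Lsharp Lflat} :=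
    Ideal.span_singleton_eq_span_singleton.mpr (associated_of_dvd_dvd hKato hLgen)
  exact (X8.bsdp_iff_span_eq_span_chromaticL_of_analyticRank_eq_zero W 3 h3 hL20 hGZK hmod hX hs h0 hf
    hSP col gen hK (fun _ => hKato)).mpr hspan

/-! ### §3. The branch equivalence and K1 by name, decomposed -/

/-- **The branch equivalence (class statement).** Modulo the split's held published inputs S4
(`SharpFlatPublishedInputsAtThree`), Sprung 2012 Thm. 7.14 (`h714`, global form) and Thm. 7.16
(`h716`), Sprung 2024 Lemmas 5.5–5.9 at all levels (`h59` = child K3), the period unit at `3`, Wuthrich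
2014 Lemma 20, GZK and modularity — all PUBLISHED named facts —
**K1's predicate on the branch X8 ∧ Surj(3) ∧ `r_an = 0` (both colours) is EQUIVALENT to `BSD(E,3)`
on that branch.** So on the branch where route `SignedLowerHalves` consumes crux 5, the crux child K1
carries NO `Λ`-adic surplus over the rung's missing input. CONDITIONAL; closes nothing.
[cite: Sprung2012, Thm. 7.14, Thm. 7.16 and Main Conj. 7.21 (pp. 1504–1505)]
[cite: Sprung2024, §5.2 Lemmas 5.5–5.9 (pp. 40–41)] [cite: Wuthrich2014, Lemma 20 (p. 399)]
[cite: Miller2011LMS, Def. 1.1] -/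
theorem sprungLowerDivisibility_branch_iff_bsdp_branch
    (hS4 : SharpFlatPublishedInputsAtThree)
    (h714 : thm714_sharpFlatSelmerDual_finite_torsion)
    (h716 : thm716_sharpFlatCharIdeal_divisibility)
    (h59 : lem59AllN_sharpFlatCharValue_rankZero)
    (h3 : realPeriodRat_eq_unit_mul_plusPeriod_three)
    (hL20 : Wuthrich2014.lemma20_surjective_threeAdic_of_semistable)
    (hGZK : rank_eq_analyticRank_of_analyticRank_le_one) (hmod : hasEntireLFunction_rat) :
    (∀ (W : WeierstrassCurve ℚ) [W.IsElliptic] [W.IsGloballyMinimal] (p : ℕ) [Fact p.Prime],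
        ClassX8 W p → Surj W p → W.analyticRank = 0 →
        ∀ col : Chroma, SprungSharpFlatLowerDivisibility W p col) ↔
    (∀ (W : WeierstrassCurve ℚ) [W.IsElliptic] [W.IsGloballyMinimal] (p : ℕ) [Fact p.Prime],
        ClassX8 W p → Surj W p → W.analyticRank = 0 → BSDp W p) := by
  refine ⟨fun hK1 W _ _ p _ hX hs h0 => ?_, fun hB W _ _ p _ hX hs h0 col => ?_⟩
  · exact bsdp_of_sprungSharpFlatLowerDivisibility hS4 h716 h59 h3 hL20 hGZK hmod W p hX hs h0
      (hK1 W p hX hs h0)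
  · exact sprungSharpFlatLowerDivisibility_of_bsdp h714 h716 h59 h3 hL20 hGZK hmod W p hX hs h0
      (hB W p hX hs h0) col

/-- **K1 BY NAME, decomposed along the assembly's branch.** Modulo the same named facts:
`SprungLowerDivisibilityAtThree ↔ (BSD(E,3) on X8 ∧ Surj(3) ∧ r_an = 0) ∧ (K1's predicate on the X8
pairs OFF that branch: ¬Surj(3) ∨ r_an ≠ 0)`. READING for the tenure planner: the crux child's open
content beyond the rung's own missing input on the branch is EXACTLY its off-branch content — positive
analytic rank (a genuinely `Λ`-adic statement: `gen(0) = 0` there) and the non-surjective rank-`0`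
pairs (Kato's exponent `n` may be positive). CONDITIONAL; closes nothing; K1 stays OPEN.
[cite: Sprung2012, Thm. 7.14, Thm. 7.16 and Main Conj. 7.21 (pp. 1504–1505)]
[cite: Sprung2024, §5.2 Lemmas 5.5–5.9 (pp. 40–41)] [cite: Wuthrich2014, Lemma 20 (p. 399)] -/
theorem sprungLowerDivisibilityAtThree_iff_bsdp_branch_and_offBranch
    (hS4 : SharpFlatPublishedInputsAtThree)
    (h714 : thm714_sharpFlatSelmerDual_finite_torsion)
    (h716 : thm716_sharpFlatCharIdeal_divisibility)
    (h59 : lem59AllN_sharpFlatCharValue_rankZero)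
    (h3 : realPeriodRat_eq_unit_mul_plusPeriod_three)
    (hL20 : Wuthrich2014.lemma20_surjective_threeAdic_of_semistable)
    (hGZK : rank_eq_analyticRank_of_analyticRank_le_one) (hmod : hasEntireLFunction_rat) :
    SprungLowerDivisibilityAtThree ↔
      ((∀ (W : WeierstrassCurve ℚ) [W.IsElliptic] [W.IsGloballyMinimal] (p : ℕ) [Fact p.Prime],
          ClassX8 W p → Surj W p → W.analyticRank = 0 → BSDp W p) ∧
        (∀ (W : WeierstrassCurve ℚ) [W.IsElliptic] [W.IsGloballyMinimal] (p : ℕ) [Fact p.Prime],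
          ClassX8 W p → (¬ Surj W p ∨ W.analyticRank ≠ 0) →
          ∀ col : Chroma, SprungSharpFlatLowerDivisibility W p col)) := by
  unfold SprungLowerDivisibilityAtThree
  refine ⟨fun hK1 => ⟨?_, fun W _ _ p _ hX _ col => hK1 W p hX col⟩, fun ⟨hB, hoff⟩ W _ _ p _ hX col => ?_⟩
  · exact (sprungLowerDivisibility_branch_iff_bsdp_branch hS4 h714 h716 h59 h3 hL20 hGZK hmod).mp
      (fun W _ _ p _ hX _ _ col => hK1 W p hX col)
  · by_cases hbr : Surj W p ∧ W.analyticRank = 0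
    · exact sprungSharpFlatLowerDivisibility_of_bsdp h714 h716 h59 h3 hL20 hGZK hmod W p hX hbr.1
        hbr.2 (hB W p hX hbr.1 hbr.2) col
    · exact hoff W p hX (not_and_or.mp hbr |>.imp id id) col

/-! ### §4. A class-shaped family of witnesses: the `3`-adic Tamagawa zone -/

/-- **X8 ∧ Surj(3) ∧ `r_an = 0` in the `3`-adic Tamagawa zone: Sprung's ♯/♭ Main Conjecture 7.21 holds
at the pair for BOTH colours, with NO per-pair certificate beyond the zone inequality.** Zone =
`L(E,1)/Ω_E = t` with `ord₃ t ≤ ord₃ ∏_ℓ c_ℓ` (equivalently `ord₃ #Ш_an ≤ 0`; `3 ∤ #E(ℚ)_tors` on X8):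
there the lower half `MissingLowerBoundAt W 3` is bookkeeping
(`missingLowerBoundAt_of_analyticRank_eq_zero_of_val_le_tamagawa`, p421292), Wuthrich 2014 Prop. 21
(`hW`, PUBLISHED) gives the upper half, so `BSDp W 3` (`X8.bsdp_of_missingLowerBoundAt_of_surj`), and §1
gives the Main Conjecture on the REAL `X^•(E/ℚ_∞)`. READING: every X8 curve of analytic rank `0` with
surjective `ρ̄_{E,3}` OUTSIDE board A8 (i.e. with `3 ∤ #Ш_an`) satisfies K1's predicate in the kernel,
modulo published facts; K1's open content on the branch is confined to the A8 cells, where §1 consumes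
the cell's certificate roads instead. CONDITIONAL on the named facts; a class-shaped statement over an
explicit numerical zone, NOT a class theorem for X8; closes nothing.
[cite: Sprung2012, Thm. 7.14, Thm. 7.16 and Main Conj. 7.21 (pp. 1504–1505)]
[cite: Sprung2024, §5.2 Lemmas 5.5–5.9 (pp. 40–41)] [cite: Wuthrich2014, Lemma 20 (p. 399) and Prop. 21 (p. 400)]
[cite: GreenbergLNM1716, §4 p. 103] [cite: Miller2011LMS, Def. 1.1] -/
theorem sprungSharpFlatMainConjecture_of_zone
    (h714 : thm714_sharpFlatSelmerDual_finite_torsion)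
    (h716 : thm716_sharpFlatCharIdeal_divisibility)
    (h59 : lem59AllN_sharpFlatCharValue_rankZero)
    (h3 : realPeriodRat_eq_unit_mul_plusPeriod_three)
    (hL20 : Wuthrich2014.lemma20_surjective_threeAdic_of_semistable)
    (hW : Wuthrich2014.sha_dvd_analyticSha)
    (hGZK : rank_eq_analyticRank_of_analyticRank_le_one) (hmod : hasEntireLFunction_rat)
    (W : WeierstrassCurve ℚ) [W.IsElliptic] [W.IsGloballyMinimal] (p : ℕ) [Fact p.Prime]
    (hX : ClassX8 W p) (hs : Surj W p) (h0 : W.analyticRank = 0)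
    {t : ℚ} (ht : W.entireLFunction 1 / (W.realPeriodRat : ℂ) = (t : ℂ))
    (hv : padicValRat p t ≤ padicValNat p W.tamagawaProduct) (col : Chroma) :
    SprungSharpFlatMainConjecture W p col := by
  have hL : W.entireLFunction 1 ≠ 0 := (W.analyticRank_eq_zero_iff_holds (hmod W)).1 h0
  have ht0 : t ≠ 0 := by
    rintro rfl
    have hΩC : (W.realPeriodRat : ℂ) ≠ 0 := Complex.ofReal_ne_zero.mpr W.realPeriodRat_pos_holds.ne'
    apply hL
    have h1 := ht
    rw [Rat.cast_zero, div_eq_iff hΩC] at h1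
    simpa using h1
  have hlow : MissingLowerBoundAt W p :=
    missingLowerBoundAt_of_analyticRank_eq_zero_of_val_le_tamagawa W p hGZK h0 (ClassX8.irr' W p hX)
      ht ht0 hv
  exact sprungSharpFlatMainConjecture_of_bsdp h714 h716 h59 h3 hL20 hGZK hmod W p hX hs h0
    (X8.bsdp_of_missingLowerBoundAt_of_surj W p hW hGZK hmod hX hs h0 hlow) col

end Summit.BirchSwinnertonDyer.BirchSwinnertonDyer.Theorems.K1Branch

end
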